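import Summits.Ventures.PercRepro.Nested

/-!
# PercRepro — the ABSTRACT Lemma B and UFL: the finite combinatorial core of C-005 (typer-2, gen 2)

The lead's canonical chain for C-005 (INBOX 2026-08-22T02:29:17Z; p3 `proofs/P3-C005-classwise.md`,
p4 `proofs/P4-C005-antipodal.md`, p1 `proofs/P1-C005-lattice.md`):
`C-005 ⇐ Lemma B on intervals ⇐ abstract Lemma B ⇐ UFL (k = 3)`.

* lattice facts about the three crossing partitions `cross4 i` (`ab|cd`, `ac|bd`, `ad|bc`):
  distinct, pairwise joins `⊤`, pairwise meets `⊥`;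
* `topBotCount c`, `crossCount c` — antipodal counting on the cube `Config S` (antipode = complement):
  the number of unordered antipodal pairs of type `{⊤, ⊥}` and of two DISTINCT crossing cells;
* **`LemmaBAbstract`** (monotone-map form, p4 / lead item (2); p3's `LemmaB` is the per-graph face form
  of the same statement, `hbase` of p4's `antipodal_principle`): for every finite `S` and every monotone
  `c : Config S → Setoid (Fin 4)`, `crossCount c ≤ topBotCount c`;
* **`UFL3`** (p3's set-family form, no monotonicity): families `F i j ⊆ 2^S` (`i ≠ j`), `F j i` the
  complements of `F i j`, the classes `C i = ⋃_j F i j` pairwise disjoint ⇒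
  `Σ_{i<j} |F i j| ≤ #{x ∪ y : x ∈ F i j, y ∈ F i' j', i ≠ i', j ≠ j'}`;
* **`LemmaBAbstract_of_UFL3`**: the admissible unions of the crossing classes of a monotone `c` are `{⊤, ⊥}`
  antipodal pairs.
-/

namespace PercRepro

open Finset

/-! ### The three crossing partitions -/

/-- Membership in `cross4 i`, read off the labels. -/
theorem cross4_rel (i : Fin 3) (a b : Fin 4) :
    cross4 i a b ↔ (![![0, 0, 1, 1], ![0, 1, 0, 1], ![0, 1, 1, 0]] i : Fin 4 → ℕ) a =
      ![![0, 0, 1, 1], ![0, 1, 0, 1], ![0, 1, 1, 0]] i b := by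
  fin_cases i <;> rfl

/-- The three crossing partitions are distinct. -/
theorem cross4_injective : Function.Injective cross4 := by
  intro i j h
  have h01 : cross4 i 0 1 ↔ cross4 j 0 1 := by rw [h]
  have h02 : cross4 i 0 2 ↔ cross4 j 0 2 := by rw [h]
  rw [cross4_rel, cross4_rel] at h01 h02
  fin_cases i <;> fin_cases j <;> simp at h01 h02 ⊢

/-- Two distinct crossing partitions meet in the discrete partition. -/
theorem cross4_inf_eq_bot {i j : Fin 3} (h : i ≠ j) : cross4 i ⊓ cross4 j = ⊥ := by
  refine le_antisymm ?_ bot_le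
  rw [Setoid.le_def]
  intro a b hab
  have h1 : cross4 i a b := hab.1
  have h2 : cross4 j a b := hab.2
  rw [cross4_rel] at h1 h2
  show a = b
  fin_cases i <;> fin_cases j <;> (try exact absurd rfl h) <;>
    fin_cases a <;> fin_cases b <;> simp at h1 h2 ⊢

/-- A setoid on `Fin 4` relating `0` to everything is `⊤`. -/
theorem Setoid.eq_top_of_rel_zero_fin4 (s : Setoid (Fin 4)) (h1 : s 0 1) (h2 : s 0 2)
    (h3 : s 0 3) : s = ⊤ := by
  refine Setoid.eq_top_iff.2 fun x y => ?_
  have h0 : ∀ z, s 0 z := by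
    intro z
    fin_cases z
    · exact s.refl 0
    · exact h1
    · exact h2
    · exact h3
  exact s.trans (s.symm (h0 x)) (h0 y)

/-- Two distinct crossing partitions join to the one-block partition (two different perfect
matchings of four points form a 4-cycle). -/
theorem cross4_sup_eq_top {i j : Fin 3} (h : i ≠ j) : cross4 i ⊔ cross4 j = ⊤ := by
  have hi : ∀ a b, cross4 i a b → (cross4 i ⊔ cross4 j) a b :=
    fun a b hab => le_sup_left (a := cross4 i) (b := cross4 j) hab
  have hj : ∀ a b, cross4 j a b → (cross4 i ⊔ cross4 j) a b :=
    fun a b hab => le_sup_right (a := cross4 i) (b := cross4 j) hab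
  have ht : ∀ a b c, (cross4 i ⊔ cross4 j) a b → (cross4 i ⊔ cross4 j) b c →
      (cross4 i ⊔ cross4 j) a c :=
    fun a b c hab hbc => (cross4 i ⊔ cross4 j).trans hab hbc
  refine Setoid.eq_top_of_rel_zero_fin4 _ ?_ ?_ ?_ <;> fin_cases i <;> fin_cases j <;>
    (try exact absurd rfl h) <;>
    first
    | (refine hi _ _ ?_; simp only [cross4_rel]; decide)
    | (refine hj _ _ ?_; simp only [cross4_rel]; decide)
    | (refine ht _ 1 _ (hi _ _ ?_) (hj _ _ ?_) <;> (simp only [cross4_rel]; decide))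
    | (refine ht _ 2 _ (hi _ _ ?_) (hj _ _ ?_) <;> (simp only [cross4_rel]; decide))
    | (refine ht _ 3 _ (hi _ _ ?_) (hj _ _ ?_) <;> (simp only [cross4_rel]; decide))

/-! ### Crossing families: pairwise incomparable cells with joins `⊤` and meets `⊥` -/

/-- A **crossing family** of cells of the partition lattice of `k` indices: distinct partitions,
pairwise joining to `⊤` and meeting in `⊥` (the two-block crossing partitions at `k = 4`, the three
two-block partitions at `k = 3`). Everything below is stated for such a family `x : Fin r → …`. -/
structure IsCrossingFamily {k r : ℕ} (x : Fin r → Setoid (Fin k)) : Prop where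
  injective : Function.Injective x
  inf_eq_bot : ∀ {i j : Fin r}, i ≠ j → x i ⊓ x j = ⊥
  sup_eq_top : ∀ {i j : Fin r}, i ≠ j → x i ⊔ x j = ⊤

/-- The three crossing partitions of four indices form a crossing family. -/
theorem cross4_isCrossingFamily : IsCrossingFamily cross4 :=
  ⟨cross4_injective, fun h => cross4_inf_eq_bot h, fun h => cross4_sup_eq_top h⟩

/-! ### Antipodal counting on a cube -/

section Counting

variable {S : Type*} [Fintype S] [DecidableEq S] {k r : ℕ}

open Classical in
/-- The number of unordered antipodal pairs `{ω, ωᶜ}` of type `{⊤, ⊥}` (counted by the `⊤` member). -/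
noncomputable def topBotCount (c : Config S → Setoid (Fin k)) : ℕ :=
  (Finset.univ.filter fun ω : Config S => c ω = ⊤ ∧ c ωᶜ = ⊥).card

open Classical in
/-- The number of unordered antipodal pairs `{ω, ωᶜ}` carrying two DISTINCT cells of the family
`x` (counted by the member in the lower-indexed cell). -/
noncomputable def crossCount (x : Fin r → Setoid (Fin k)) (c : Config S → Setoid (Fin k)) : ℕ :=
  (Finset.univ.filter fun ω : Config S =>
    ∃ i j : Fin r, i < j ∧ c ω = x i ∧ c ωᶜ = x j).card

/-- The class `C i = ⋃_j F i j` of an `r × r` family of subsets of the cube. -/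
def classOf (F : Fin r → Fin r → Finset (Config S)) (i : Fin r) : Finset (Config S) :=
  Finset.univ.biUnion (F i)

open Classical in
/-- The admissible unions `x ∪ y`, `x ∈ F i j`, `y ∈ F i' j'`, `i ≠ i'`, `j ≠ j'`. -/
noncomputable def admissibleUnions (F : Fin r → Fin r → Finset (Config S)) :
    Finset (Config S) :=
  Finset.univ.filter fun z => ∃ i j i' j' : Fin r, i ≠ i' ∧ j ≠ j' ∧
    ∃ x ∈ F i j, ∃ y ∈ F i' j', z = x ⊔ y

end Counting

/-- **Lemma B for a crossing family** (monotone-map form): for every finite `S` and every monotone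
`c : Config S → Setoid (Fin k)`, the antipodal pairs carrying two distinct cells of `x` are at most
the antipodal pairs of type `{⊤, ⊥}`. -/
def LemmaBFamily {k r : ℕ} (x : Fin r → Setoid (Fin k)) : Prop :=
  ∀ {S : Type} [Fintype S] [DecidableEq S] (c : Config S → Setoid (Fin k)), Monotone c →
    crossCount x c ≤ topBotCount c

/-- **Lemma B** (C-005.md, p4 / lead 02:29:17Z item (2)): the abstract Lemma B for the three
crossing partitions of four indices. Abstract (no graph): true for `|S| ≤ 6` (p1, SMT). -/
def LemmaBAbstract : Prop := LemmaBFamily cross4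

/-- **UFL (`r` classes)** (p3, `proofs/P3-C005-classwise.md` §3; no monotonicity): for families
`F i j ⊆ 2^S` (`F i i = ∅`) with `F j i` the complements of `F i j` and pairwise disjoint classes
`C i = ⋃_j F i j`, the admissible unions are at least `Σ_{i<j} |F i j|`. -/
def UFL (r : ℕ) : Prop :=
  ∀ {S : Type} [Fintype S] [DecidableEq S] (F : Fin r → Fin r → Finset (Config S)),
    (∀ i, F i i = ∅) → (∀ i j, F j i = (F i j).image compl) →
    (∀ i i', i ≠ i' → Disjoint (classOf F i) (classOf F i')) →
    ∑ i : Fin r, ∑ j : Fin r, (if i < j then (F i j).card else 0) ≤ (admissibleUnions F).card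

/-- **UFL (k = 3)** — the three-class case, the set-theoretic core of C-005. -/
def UFL3 : Prop := UFL 3

/-! ### UFL implies Lemma B (for any crossing family) -/

section Implication

variable {S : Type} [Fintype S] [DecidableEq S] {k r : ℕ} (x : Fin r → Setoid (Fin k))
  (c : Config S → Setoid (Fin k))

open Classical in
/-- The crossing classes of a map: `crossFam x c i j = {ω | c ω = x_i, c ωᶜ = x_j}` (`i ≠ j`). -/
noncomputable def crossFam (i j : Fin r) : Finset (Config S) :=
  if i = j then ∅ else Finset.univ.filter fun ω => c ω = x i ∧ c ωᶜ = x j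

/-- Membership in a crossing class. -/
theorem mem_crossFam {i j : Fin r} {ω : Config S} :
    ω ∈ crossFam x c i j ↔ i ≠ j ∧ c ω = x i ∧ c ωᶜ = x j := by
  unfold crossFam
  split_ifs with h
  · simp [h]
  · simp [h]

/-- The diagonal classes are empty. -/
theorem crossFam_self (i : Fin r) : crossFam x c i i = ∅ := by simp [crossFam]

/-- `crossFam x c j i` is the set of complements of `crossFam x c i j`. -/
theorem crossFam_swap (i j : Fin r) : crossFam x c j i = (crossFam x c i j).image compl := by
  ext ω
  rw [Finset.mem_image, mem_crossFam]
  constructor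
  · rintro ⟨hne, h1, h2⟩
    exact ⟨ωᶜ, (mem_crossFam x c).2 ⟨hne.symm, h2, by rw [compl_compl]; exact h1⟩, compl_compl ω⟩
  · rintro ⟨y, hy, rfl⟩
    obtain ⟨hne, h1, h2⟩ := (mem_crossFam x c).1 hy
    exact ⟨hne.symm, h2, by rw [compl_compl]; exact h1⟩

/-- Every member of the class `C i` of `crossFam x c` lies in the cell `x i`. -/
theorem eq_of_mem_classOf_crossFam {i : Fin r} {ω : Config S}
    (h : ω ∈ classOf (crossFam x c) i) : c ω = x i := by
  obtain ⟨j, -, hj⟩ := Finset.mem_biUnion.1 h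
  exact ((mem_crossFam x c).1 hj).2.1

/-- The classes of `crossFam x c` are pairwise disjoint (the cells are distinct). -/
theorem disjoint_classOf_crossFam (hx : Function.Injective x) {i i' : Fin r} (h : i ≠ i') :
    Disjoint (classOf (crossFam x c) i) (classOf (crossFam x c) i') := by
  rw [Finset.disjoint_left]
  intro ω h1 h2
  exact h (hx ((eq_of_mem_classOf_crossFam x c h1).symm.trans
    (eq_of_mem_classOf_crossFam x c h2)))

/-- The pairs `(i, j)` with `i < j`. -/
def ltPairs (r : ℕ) : Finset (Fin r × Fin r) := Finset.univ.filter fun p => p.1 < p.2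

/-- `crossCount` is the sum of the sizes of the crossing classes over `i < j`. -/
theorem crossCount_eq_sum (hx : Function.Injective x) :
    crossCount x c = ∑ i : Fin r, ∑ j : Fin r, (if i < j then (crossFam x c i j).card else 0) := by
  classical
  have hset : (Finset.univ.filter fun ω : Config S =>
      ∃ i j : Fin r, i < j ∧ c ω = x i ∧ c ωᶜ = x j) =
      (ltPairs r).biUnion fun p => crossFam x c p.1 p.2 := by
    ext ω
    simp only [Finset.mem_filter, Finset.mem_univ, true_and, Finset.mem_biUnion, ltPairs,
      mem_crossFam]
    constructor
    · rintro ⟨i, j, hij, h1, h2⟩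
      exact ⟨(i, j), hij, hij.ne, h1, h2⟩
    · rintro ⟨⟨i, j⟩, hij, -, h1, h2⟩
      exact ⟨i, j, hij, h1, h2⟩
  have hdisj : ∀ p ∈ ltPairs r, ∀ q ∈ ltPairs r, p ≠ q →
      Disjoint (crossFam x c p.1 p.2) (crossFam x c q.1 q.2) := by
    intro p _ q _ hpq
    rw [Finset.disjoint_left]
    intro ω hp hq
    obtain ⟨-, h1, h2⟩ := (mem_crossFam x c).1 hp
    obtain ⟨-, h1', h2'⟩ := (mem_crossFam x c).1 hq
    exact hpq (Prod.ext (hx (h1.symm.trans h1')) (hx (h2.symm.trans h2')))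
  rw [crossCount, hset, Finset.card_biUnion hdisj, ltPairs, Finset.sum_filter,
    Fintype.sum_prod_type]

open Classical in
/-- An admissible union of two crossing classes is a `{⊤, ⊥}` antipodal pair. -/
theorem admissibleUnions_subset (hx : IsCrossingFamily x) (hc : Monotone c) :
    admissibleUnions (crossFam x c) ⊆ Finset.univ.filter fun ω => c ω = ⊤ ∧ c ωᶜ = ⊥ := by
  intro z hz
  rw [admissibleUnions, Finset.mem_filter] at hz
  obtain ⟨-, i, j, i', j', hii', hjj', y, hy, y', hy', rfl⟩ := hz
  obtain ⟨-, hy1, hy2⟩ := (mem_crossFam x c).1 hy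
  obtain ⟨-, hy1', hy2'⟩ := (mem_crossFam x c).1 hy'
  rw [Finset.mem_filter]
  refine ⟨Finset.mem_univ _, ?_, ?_⟩
  · refine top_unique ?_
    rw [← hx.sup_eq_top hii', ← hy1, ← hy1']
    exact sup_le (hc le_sup_left) (hc le_sup_right)
  · refine le_bot_iff.1 ?_
    rw [← hx.inf_eq_bot hjj', ← hy2, ← hy2', compl_sup]
    exact le_inf (hc inf_le_left) (hc inf_le_right)

end Implication

/-- **UFL implies Lemma B for every crossing family of `r` cells**: apply UFL to the crossing
classes of a monotone map; the admissible unions are `{⊤, ⊥}` antipodal pairs. -/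
theorem LemmaBFamily_of_UFL {k r : ℕ} {x : Fin r → Setoid (Fin k)} (hx : IsCrossingFamily x)
    (h : UFL r) : LemmaBFamily x := by
  intro S _ _ c hc
  classical
  have key := h (crossFam x c) (crossFam_self x c) (crossFam_swap x c)
    (fun i i' hii' => disjoint_classOf_crossFam x c hx.injective hii')
  rw [← crossCount_eq_sum x c hx.injective] at key
  exact key.trans (Finset.card_le_card (admissibleUnions_subset x c hx hc))

/-- **UFL (k = 3) implies Lemma B** (the three crossing partitions of four indices). -/
theorem LemmaBAbstract_of_UFL3 (h : UFL3) : LemmaBAbstract :=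
  LemmaBFamily_of_UFL cross4_isCrossingFamily h

/-! ### Generic sum lemmas used by the grouping (`FaceGrouping.lean`) -/

section Sums

variable {E : Type*} [Fintype E] [DecidableEq E]

open Classical in
/-- A probability of a set given by a predicate, as a sum of weights. -/
theorem prob_setOf (p : E → ℝ) (P : Config E → Prop) :
    prob p {ω | P ω} = ∑ ω : Config E, if P ω then weight p ω else 0 := by
  unfold prob
  refine Finset.sum_congr rfl fun ω _ => ?_
  by_cases h : P ω <;> simp [Set.indicator, h]

open Classical in
/-- A product of two such probabilities as a double sum. -/
theorem prob_mul_prob_eq (p : E → ℝ) (P Q : Config E → Prop) :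
    prob p {ω | P ω} * prob p {ω | Q ω} =
      ∑ ω : Config E, ∑ ω' : Config E, weight p ω * weight p ω' * if P ω ∧ Q ω' then 1 else 0 := by
  rw [prob_setOf, prob_setOf, Finset.sum_mul_sum]
  refine Finset.sum_congr rfl fun ω _ => Finset.sum_congr rfl fun ω' _ => ?_
  by_cases h1 : P ω <;> by_cases h2 : Q ω' <;> simp [h1, h2]

/-- Moving the two inner sums of a fourfold sum to the outside. -/
theorem sum_comm4 {α β γ δ M : Type*} [Fintype α] [Fintype β] [Fintype γ] [Fintype δ]
    [AddCommMonoid M] (f : α → β → γ → δ → M) :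
    ∑ a, ∑ b, ∑ c, ∑ d, f a b c d = ∑ c, ∑ d, ∑ a, ∑ b, f a b c d := by
  calc ∑ a, ∑ b, ∑ c, ∑ d, f a b c d = ∑ a, ∑ c, ∑ b, ∑ d, f a b c d :=
        Finset.sum_congr rfl fun a _ => Finset.sum_comm
    _ = ∑ c, ∑ a, ∑ b, ∑ d, f a b c d := Finset.sum_comm
    _ = ∑ c, ∑ a, ∑ d, ∑ b, f a b c d :=
        Finset.sum_congr rfl fun c _ => Finset.sum_congr rfl fun a _ => Finset.sum_comm
    _ = ∑ c, ∑ d, ∑ a, ∑ b, f a b c d := Finset.sum_congr rfl fun c _ => Finset.sum_comm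

end Sums

/-! ### The Hall / up-closure form of Lemma B (p1's matching result, lead 02:37:32Z) -/

section Hall

variable {S : Type*} [Fintype S] [DecidableEq S] {k r : ℕ}

open Classical in
/-- The bad members: `ω` with `(c ω, c ωᶜ)` two distinct cells of `x`, `i < j` (one per pair). -/
noncomputable def badSet (x : Fin r → Setoid (Fin k)) (c : Config S → Setoid (Fin k)) :
    Finset (Config S) :=
  Finset.univ.filter fun ω => ∃ i j : Fin r, i < j ∧ c ω = x i ∧ c ωᶜ = x j

open Classical in
/-- The good members: `ω` with `c ω = ⊤` and `c ωᶜ = ⊥` (one per `{⊤, ⊥}` pair). -/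
noncomputable def goodSet (c : Config S → Setoid (Fin k)) : Finset (Config S) :=
  Finset.univ.filter fun ω => c ω = ⊤ ∧ c ωᶜ = ⊥

/-- The good pair `{C, Cᶜ}` lies ABOVE the bad pair `{A, Aᶜ}`: its `⊤` member contains a member. -/
def above (A C : Config S) : Prop := A ≤ C ∨ Aᶜ ≤ C

open Classical in
/-- The good members above some member of a family of bad members. -/
noncomputable def goodAbove (c : Config S → Setoid (Fin k)) (F : Finset (Config S)) :
    Finset (Config S) :=
  (goodSet c).filter fun C => ∃ A ∈ F, above A C

/-- `crossCount` is the size of the bad set. -/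
theorem crossCount_eq_card_badSet (x : Fin r → Setoid (Fin k)) (c : Config S → Setoid (Fin k)) :
    crossCount x c = (badSet x c).card := rfl

/-- `topBotCount` is the size of the good set. -/
theorem topBotCount_eq_card_goodSet (c : Config S → Setoid (Fin k)) :
    topBotCount c = (goodSet c).card := rfl

end Hall

/-- **The Hall (up-closure) form of Lemma B for a crossing family**: for every monotone `c` and every
family `F` of bad pairs, at least `|F|` good pairs lie above a member of `F`. -/
def HallFormFamily {k r : ℕ} (x : Fin r → Setoid (Fin k)) : Prop :=
  ∀ {S : Type} [Fintype S] [DecidableEq S] (c : Config S → Setoid (Fin k)), Monotone c →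
    ∀ F ⊆ badSet x c, F.card ≤ (goodAbove c F).card

/-- **The Hall form of Lemma B** (p1, `proofs/P1-C005-lattice.md` §8; lead 02:37:32Z) for the three
crossing partitions of four indices. By Hall's marriage theorem it is equivalent to a monotone
injection `bad ↦ good-above`; it implies Lemma B (`LemmaBAbstract_of_HallForm`). -/
def HallForm : Prop := HallFormFamily cross4

/-- **The Hall form implies Lemma B** for any family (Hall's marriage theorem gives an injection of
the bad pairs into the good pairs). -/
theorem LemmaBFamily_of_HallFormFamily {k r : ℕ} {x : Fin r → Setoid (Fin k)}
    (h : HallFormFamily x) : LemmaBFamily x := by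
  intro S _ _ c hc
  classical
  have hall : ∀ s : Finset (badSet x c),
      s.card ≤ (s.biUnion fun A => (goodSet c).filter fun C => above A.1 C).card := by
    intro s
    have hsub : s.image Subtype.val ⊆ badSet x c := by
      intro A hA
      obtain ⟨A', _, rfl⟩ := Finset.mem_image.1 hA
      exact A'.2
    have h1 := h c hc (s.image Subtype.val) hsub
    rw [Finset.card_image_of_injective _ Subtype.val_injective] at h1
    refine h1.trans (Finset.card_le_card ?_)
    intro C hC
    simp only [goodAbove, Finset.mem_filter, Finset.mem_image] at hC
    obtain ⟨hCg, A, ⟨A', hA', rfl⟩, hab⟩ := hC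
    exact Finset.mem_biUnion.2 ⟨A', hA', Finset.mem_filter.2 ⟨hCg, hab⟩⟩
  obtain ⟨f, hf, hft⟩ := (Finset.all_card_le_biUnion_card_iff_exists_injective _).1 hall
  have hrange : ∀ A : badSet x c, f A ∈ goodSet c := fun A => (Finset.mem_filter.1 (hft A)).1
  rw [crossCount_eq_card_badSet, topBotCount_eq_card_goodSet, ← Fintype.card_coe (badSet x c),
    ← Fintype.card_coe (goodSet c)]
  exact Fintype.card_le_of_injective (fun A => (⟨f A, hrange A⟩ : goodSet c))
    fun A B hAB => hf (congrArg Subtype.val hAB)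

/-- **The Hall form implies the abstract Lemma B** (four indices). -/
theorem LemmaBAbstract_of_HallForm (h : HallForm) : LemmaBAbstract :=
  LemmaBFamily_of_HallFormFamily h

end PercRepro
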